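import Summits.Ventures.PercRepro.S2ClusterRowsFour
import Summits.Ventures.PercRepro.S2HitTools

/-!
# PercRepro — S2: THE ROWS `t ≤ 3` OF THE CELL `(13, 6)` MODULO ONLY THE SPREAD CAP `s₄ ≤ 30` (p7, gen 16; sub-claim S2)

The coloop-free spread rows `t ≤ 3` of the cell `(13, 6)` close on the hitting lever with the GLOBAL caps `s₅ ≤ 158`
(`caps_thirteen_six_cf`) and `s₆ ≤ C(11, 6) = 462` once the `4`-circuits are capped by `s₄ ≤ 30` (p1's spread chain; here a
HYPOTHESIS): a top `5`-set meets at least two of any three distinct circuits (`S2.ncard_subsets_two_of_three_add_le`, worst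
cases `S2.hit_two_of_three_*`), the spanning `13`-sets are bases and contain none of three circuits
(`S2.ncard_spanning_add_le_of_three_circuits`), and a top `5`-set is independent, hence above no triangle
(`S2.ncard_top_five_add_le_of_two_meeting_triangles`). **`c025_thirteen_six_cf_spread_le_three_of_cap`**, row by row:
`t = 0` — three `4`-circuits (`U ≤ 10341 + 3150 + 2212 + 462 = 16165` against `16386` at `m = 139`, `S ≤ 37790`), two
`4`-circuits (`14050`), two `5`-circuits (`14281`), neither (`12209`); `t = 1` — the triangle with two `4`-circuits
(`9694 + 6384 = 16078` against `16460` at `m = 135`, `S ≤ 34787`), one `4`-circuit (`14175`), a `5`-circuit (`14400`),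
neither (`12650`); `t = 2` — two triangles with a `4`-circuit, disjoint (`9009 + 6944 = 15953` against `16571`, `S ≤ 30497`)
or meeting (`9626 − 239 + 6944 = 16331` against `16534`, `S ≤ 31784`), no `4`-circuit (`14135`); `t = 3` — three triangles
(`8271 + 7504 = 15775` against `16608`, `S ≤ 28781`). With `c025_core_five_thirteen_six_of_three`:
**`c025_core_five_thirteen_six_of_cap`** — THE CELL `(13, 6)` MODULO THE ONE CAP `s₄ ≤ 30` ON ITS COLOOP-FREE SPREAD CORE.
Nothing about any cell is claimed; the window of record is `8 ≤ p ≤ 14`. Axioms: standard.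
-/

open scoped Matroid

namespace PercRepro

namespace ThmN

open Set

variable {α : Type}

/-- **The coloop-free spread rows `t ≤ 3` of the cell `(13, 6)` modulo the spread cap `s₄ ≤ 30`.** -/
theorem c025_thirteen_six_cf_spread_le_three_of_cap (M : Matroid α) [M.Finite]
    (hR : M.eRank = ((13 : ℕ) : ℕ∞)) (hn : M.E.ncard = 13 + 6)
    (hfree : ∀ e ∈ M.E, ∃ A ⊆ M.E \ {e}, e ∉ M.closure A ∧ e ∉ M.closure ((M.E \ {e}) \ A)) (hK : ∀ e, ¬ M.IsColoop e)
    (h4 : ¬ ∃ W ⊆ M.E, W.ncard ≤ 9 ∧ W.encard = M.eRk W + 4)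
    (hs4c : {C : Set α | M.IsCircuit C ∧ C.ncard = 4}.ncard ≤ 30)
    (ht3 : {C : Set α | M.IsCircuit C ∧ C.ncard = 3}.ncard ≤ 3) : RLS M 13 5 := by
  classical
  have hd : M.E.encard = M.eRank + ((6 : ℕ) : ℕ∞) := by
    rw [hR, ← M.ground_finite.cast_ncard_eq, hn]
    push_cast
    ring
  obtain ⟨hs3, -, hs5⟩ := caps_thirteen_six_cf M hd hn hfree hK
  have hs6 : {C : Set α | M.IsCircuit C ∧ C.ncard = 6}.ncard ≤ (6 + 5).choose 6 :=
    Matroid.ncard_circuits_le_choose_of_encard M hd 5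
  norm_num [Nat.choose] at hs6
  have hflat : ∀ X ⊆ M.E, M.eRk X ≤ 5 → X.ncard ≤ 8 := fun X hX hr => by
    have := S2.ncard_le_of_eRk_le_of_not_nullity M 4 9 (by norm_num) h4 hX (r := 5) (by norm_num) (by exact_mod_cast hr)
    omega
  have hflat' : ∀ X ⊆ M.E, M.eRk X ≤ 4 → X.ncard ≤ 7 := fun X hX hr => by
    have := S2.ncard_le_of_eRk_le_of_not_nullity M 4 9 (by norm_num) h4 hX (r := 4) (by norm_num) (by exact_mod_cast hr)
    omega
  have hEcard : M.ground_finite.toFinset.card = 13 + 6 := by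
    rw [← Set.ncard_eq_toFinset_card _ M.ground_finite]; exact hn
  have hL0 : ∀ e ∈ M.E, ¬ M.IsLoop e := not_isLoop_of_free M hfree
  have hs : ∀ e ∈ M.E, ∀ f ∈ M.E, e ≠ f → M.eRk {e, f} = 2 := by
    intro e he f hf hef
    have h2 : (2 : ℕ∞) ≤ M.eRk {e, f} :=
      two_le_eRk_of_two_le_ncard_of_free M hfree (pair_subset he hf) (by rw [ncard_pair hef])
    have h3 : M.eRk {e, f} ≤ 2 := by
      have := M.eRk_le_encard {e, f}
      rwa [encard_pair hef] at this
    exact le_antisymm h3 h2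
  have hC1 : ∀ L ⊆ M.E, M.eRk L = 2 → L.ncard ≤ 3 :=
    fun L hL hr => ncard_le_three_of_eRk_two M hs hfree hL hr
  have hcirc : ∀ C, M.IsCircuit C → 3 ≤ C.encard := three_le_encard_of_circuit M hL0 hs
  have hTfin : {C : Set α | M.IsCircuit C ∧ C.ncard = 3}.Finite :=
    M.ground_finite.finite_subsets.subset (fun C hC => hC.1.subset_ground)
  have h4fin : {C : Set α | M.IsCircuit C ∧ C.ncard = 4}.Finite :=
    M.ground_finite.finite_subsets.subset (fun C hC => hC.1.subset_ground)
  have h5fin : {C : Set α | M.IsCircuit C ∧ C.ncard = 5}.Finite :=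
    M.ground_finite.finite_subsets.subset (fun C hC => hC.1.subset_ground)
  have hfin : ∀ {T : Set α}, M.IsCircuit T → T.Finite := fun hT => M.ground_finite.subset hT.subset_ground
  -- the cell inequality with `K = 9480`, `Φ(13, 5) = 1742 / 63 ≤ 2^18 / 9480`
  have cellA : ∀ (U S m : ℕ) (A : ℚ), Matroid.topCount M 13 5 ≤ U →
      {X : Set α | X ⊆ M.E ∧ M.eRk X = M.eRank}.ncard ≤ S → m ≤ 1024 →
      1024 * (U : ℚ) ≤ ((1024 - m : ℕ) : ℚ) * 2 ^ (6 - 5) * (9480 : ℚ) →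
      (1024 : ℚ) * (A + (S : ℚ)) ≤ (m : ℚ) * 2 ^ 19 →
      ({X : Set α | X ⊆ M.E ∧ M.eRk X ≤ 5}.ncard : ℚ) ≤ A → RLS M 13 5 := by
    intro U S m A hU hS hm hpoly htail hA
    rw [RLS_iff]
    exact c025_core_five_cell_of_counts_xqictq5g M 13 6 (by norm_num) hR hn U hU _ hA S hS
      9480 (by norm_num) (phiK 13 5) (by rw [phiK_thirteen_five]; norm_num) ⟨m, hm, hpoly, htail⟩
  -- the top count is the top `5`-sets plus the top `6`-sets
  have hU1 := S2.topCount_le_ncard_compl_spanning (M := M) hR hd 5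
  simp only [Nat.cast_ofNat] at hU1
  have hsplit : {B : Set α | B ⊆ M.E ∧ M.eRk B = 5 ∧ B.ncard ≤ 6 ∧ M.eRk (M.E \ B) = M.eRank}.ncard ≤
      {B : Set α | B ⊆ M.E ∧ B.ncard = 5 ∧ M.eRk B = 5 ∧ M.eRk (M.E \ B) = M.eRank}.ncard +
      {B : Set α | B ⊆ M.E ∧ B.ncard = 6 ∧ M.eRk B = 5 ∧ M.eRk (M.E \ B) = M.eRank}.ncard := by
    refine le_trans (Set.ncard_le_ncard ?_ ((M.ground_finite.finite_subsets.subset (fun B hB => hB.1)).union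
      (M.ground_finite.finite_subsets.subset (fun B hB => hB.1)))) (Set.ncard_union_le _ _)
    rintro B ⟨hBE, hB5, hB6, hBs⟩
    have hBfin : B.Finite := M.ground_finite.subset hBE
    have h5le : 5 ≤ B.ncard := by
      have := M.eRk_le_encard B
      rw [hB5, ← hBfin.cast_ncard_eq] at this
      exact_mod_cast this
    rcases (show B.ncard = 5 ∨ B.ncard = 6 by omega) with h | h
    · exact Or.inl ⟨hBE, h, hB5, hBs⟩
    · exact Or.inr ⟨hBE, h, hB5, hBs⟩
  have hUsum : Matroid.topCount M 13 5 ≤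
      {B : Set α | B ⊆ M.E ∧ B.ncard = 5 ∧ M.eRk B = 5 ∧ M.eRk (M.E \ B) = M.eRank}.ncard +
      {B : Set α | B ⊆ M.E ∧ B.ncard = 6 ∧ M.eRk B = 5 ∧ M.eRk (M.E \ B) = M.eRank}.ncard := hU1.trans hsplit
  set Top := {B : Set α | B ⊆ M.E ∧ B.ncard = 5 ∧ M.eRk B = 5 ∧ M.eRk (M.E \ B) = M.eRank} with hTop
  -- the top `5`-sets against two sets they all meet
  have htop5_le : ∀ (Y₁ Y₂ : Set α), (∀ B ⊆ M.E, B.ncard = 5 → M.eRk (M.E \ B) = M.eRank → (B ∩ Y₁).Nonempty) →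
      (∀ B ⊆ M.E, B.ncard = 5 → M.eRk (M.E \ B) = M.eRank → (B ∩ Y₂).Nonempty) →
      Top.ncard + (M.E \ Y₁).ncard.choose 5 + (M.E \ Y₂).ncard.choose 5 ≤ 11628 + (M.E \ (Y₁ ∪ Y₂)).ncard.choose 5 := by
    intro Y₁ Y₂ h1 h2
    have := S2.ncard_top_five_add_le_of_hit M Y₁ Y₂ h1 h2
    rw [hn] at this
    norm_num [Nat.choose] at this
    exact this
  have htop5_all : Top.ncard ≤ 11628 := by
    have hsub : Top ⊆ {X : Set α | X ⊆ M.E ∧ X.ncard = 5} := fun B hB => ⟨hB.1, hB.2.1⟩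
    have := Set.ncard_le_ncard hsub (M.ground_finite.finite_subsets.subset (fun X hX => hX.1))
    rw [S2.ncard_subsets_ncard_eq M.E M.ground_finite 5, hn] at this
    norm_num [Nat.choose] at this
    exact this
  -- the complement of a union of two circuits: `|E ∖ (C₁ ∪ C₂)| ≥ 19 − |C₁| − |C₂|`
  have hcompl : ∀ {C₁ C₂ : Set α}, C₁ ⊆ M.E → C₂ ⊆ M.E → 19 ≤ (M.E \ (C₁ ∪ C₂)).ncard + C₁.ncard + C₂.ncard := by
    intro C₁ C₂ h₁ h₂
    have hY : C₁ ∪ C₂ ⊆ M.E := Set.union_subset h₁ h₂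
    have h := Set.ncard_sdiff_add_ncard_of_subset hY M.ground_finite
    have hu := Set.ncard_union_le C₁ C₂
    omega
  -- the top `6`-sets through circuits, with the per-triangle charge `560` and the caps
  have htop6 : {B : Set α | B ⊆ M.E ∧ B.ncard = 6 ∧ M.eRk B = 5 ∧ M.eRk (M.E \ B) = M.eRank}.ncard ≤
      {C : Set α | M.IsCircuit C ∧ C.ncard = 3}.ncard * 560 + {C : Set α | M.IsCircuit C ∧ C.ncard = 4}.ncard * 105 +
        {C : Set α | M.IsCircuit C ∧ C.ncard = 5}.ncard * 14 + {C : Set α | M.IsCircuit C ∧ C.ncard = 6}.ncard := by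
    have hc560 : ∀ T : Set α, M.IsCircuit T → T.ncard = 3 →
        {B : Set α | B ⊆ M.E ∧ B.ncard = 6 ∧ T ⊆ B ∧ M.eRk (M.E \ B) = M.eRank}.ncard ≤ 560 := by
      intro T hT hT3
      have hsub : {B : Set α | B ⊆ M.E ∧ B.ncard = 6 ∧ T ⊆ B ∧ M.eRk (M.E \ B) = M.eRank} ⊆
          {X : Set α | X ⊆ M.E ∧ X.ncard = 6 ∧ T ⊆ X} := fun B hB => ⟨hB.1, hB.2.1, hB.2.2.1⟩
      have h := (Set.ncard_le_ncard hsub (M.ground_finite.finite_subsets.subset (fun X hX => hX.1))).trans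
        (S2.ncard_subsets_superset_le M hT.subset_ground 6)
      rw [hn, hT3] at h
      norm_num [Nat.choose] at h
      exact h
    have := S2.ncard_top_six_le M hn hcirc 560 hc560
    norm_num [Nat.choose] at this
    exact this
  -- the spanning counts: all sets of corank `≤ 6`, and the three-triangle Bonferroni
  have hSkit : {X : Set α | X ⊆ M.E ∧ M.eRk X = M.eRank}.ncard ≤ 43796 := by
    have hS := Matroid.ncard_spanning_le (M := M) hd
    rw [hEcard] at hS
    exact hS.trans (by decide)
  have hspan3 : 3 ≤ {C : Set α | M.IsCircuit C ∧ C.ncard = 3}.ncard →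
      {X : Set α | X ⊆ M.E ∧ M.eRk X = M.eRank}.ncard ≤ 28781 := by
    intro h3
    obtain ⟨T₁, T₂, T₃, hT₁, hT₂, hT₃, h12, h13, h23⟩ := (Set.two_lt_ncard_iff hTfin).1 (by omega)
    have hS := S2.ncard_spanning_add_le_of_three_triangles M hR hn (by norm_num) hC1 hT₁.1 hT₁.2 hT₂.1 hT₂.2
      hT₃.1 hT₃.2 h12 h13 h23
    norm_num [Finset.sum_range_succ, Nat.choose] at hS
    omega
  -- the exact triangle count `t ≤ 3` and the rank part of the tail at `t` with the caps `30`, `158`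
  obtain ⟨t, ht⟩ : ∃ t, {C : Set α | M.IsCircuit C ∧ C.ncard = 3}.ncard = t := ⟨_, rfl⟩
  have hA := ncard_eRk_le_five_le_spread M 13 6 (by norm_num) hR hn hfree hflat hflat' t 30 158 ht.le hs4c hs5
  rw [ht] at hs3 hspan3 htop6 ht3
  by_cases ht0 : t = 0
  · subst ht0
    by_cases h43 : 3 ≤ {C : Set α | M.IsCircuit C ∧ C.ncard = 4}.ncard
    · -- three `4`-circuits: a top `5`-set meets two of them; the spanning `13`-sets contain none
      obtain ⟨C₁, C₂, C₃, hC₁, hC₂, hC₃, h12, h13, h23⟩ := (Set.two_lt_ncard_iff h4fin).1 (by omega)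
      have hh := S2.top_five_two_of_three M hR hn hC₁.1 hC₂.1 hC₃.1 h12 h13 h23
      have hle := S2.ncard_top_five_le_two_of_three M hh
      rw [← hTop] at hle
      have hcount := S2.ncard_two_of_three_family_add_le M hn hC₁.1.subset_ground hC₂.1.subset_ground hC₃.1.subset_ground
      obtain ⟨a1, a2, a3, b1, b2, b3, b4, b5, b6, c1, c2, c3, c4⟩ := S2.three_circuits_ncard_bounds M hC₁.1 hC₂.1 hC₃.1 h12 h13 h23
      have e₁ := hC₁.2
      have e₂ := hC₂.2
      have e₃ := hC₃.2
      have hx := S2.hit_two_of_three_444 _ _ _ _ _ (by omega) (by omega) (by omega) (by omega) (by omega) (by omega)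
        c1 c2 c3 (by omega) hcount
      have hS := S2.ncard_spanning_add_le_of_three_circuits_nineteen M hR hn hC₁.1 hC₂.1 hC₃.1 (by omega) (by omega) (by omega)
      rw [hC₁.2, hC₂.2, hC₃.2] at hS
      have m12 : (19 - (C₁ ∪ C₂).ncard).choose 6 ≤ 3003 := S2.choose_six_le_of_five_le (by omega)
      have m13 : (19 - (C₁ ∪ C₃).ncard).choose 6 ≤ 3003 := S2.choose_six_le_of_five_le (by omega)
      have m23 : (19 - (C₂ ∪ C₃).ncard).choose 6 ≤ 3003 := S2.choose_six_le_of_five_le (by omega)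
      norm_num [Nat.choose] at hS
      have hS' : {X : Set α | X ⊆ M.E ∧ M.eRk X = M.eRank}.ncard ≤ 37790 := by omega
      have hU' : Matroid.topCount M 13 5 ≤ 16165 := by omega
      exact cellA _ 37790 139 _ hU' hS' (by norm_num) (by norm_num) (by norm_num [Nat.choose]) hA
    push Not at h43
    by_cases h42 : 2 ≤ {C : Set α | M.IsCircuit C ∧ C.ncard = 4}.ncard
    · -- two `4`-circuits: every top `5`-set meets their union of `≤ 8` points
      obtain ⟨C₁, C₂, hC₁, hC₂, hne⟩ := (Set.one_lt_ncard_iff h4fin).1 (by omega)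
      have hhit := S2.top_five_inter_union_nonempty M hR hn hC₁.1 hC₂.1 hne
      have h5b := htop5_le (C₁ ∪ C₂) (C₁ ∪ C₂) hhit hhit
      rw [Set.union_self] at h5b
      have hY := hcompl hC₁.1.subset_ground hC₂.1.subset_ground
      rw [hC₁.2, hC₂.2] at hY
      have hch : (11 : ℕ).choose 5 ≤ (M.E \ (C₁ ∪ C₂)).ncard.choose 5 := Nat.choose_le_choose 5 (by omega)
      norm_num [Nat.choose] at hch
      have hU' : Matroid.topCount M 13 5 ≤ 14050 := by omega
      exact cellA _ 43796 151 _ hU' hSkit (by norm_num) (by norm_num) (by norm_num [Nat.choose]) hA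
    push Not at h42
    by_cases h52 : 2 ≤ {C : Set α | M.IsCircuit C ∧ C.ncard = 5}.ncard
    · -- two `5`-circuits: their union has `≤ 10` points
      obtain ⟨C₁, C₂, hC₁, hC₂, hne⟩ := (Set.one_lt_ncard_iff h5fin).1 (by omega)
      have hhit := S2.top_five_inter_union_nonempty M hR hn hC₁.1 hC₂.1 hne
      have h5b := htop5_le (C₁ ∪ C₂) (C₁ ∪ C₂) hhit hhit
      rw [Set.union_self] at h5b
      have hY := hcompl hC₁.1.subset_ground hC₂.1.subset_ground
      rw [hC₁.2, hC₂.2] at hY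
      have hch : (9 : ℕ).choose 5 ≤ (M.E \ (C₁ ∪ C₂)).ncard.choose 5 := Nat.choose_le_choose 5 (by omega)
      norm_num [Nat.choose] at hch
      have hU' : Matroid.topCount M 13 5 ≤ 14281 := by omega
      exact cellA _ 43796 151 _ hU' hSkit (by norm_num) (by norm_num) (by norm_num [Nat.choose]) hA
    · push Not at h52
      have hU' : Matroid.topCount M 13 5 ≤ 12209 := by omega
      exact cellA _ 43796 151 _ hU' hSkit (by norm_num) (by norm_num) (by norm_num [Nat.choose]) hA
  by_cases ht1 : t = 1
  · subst ht1
    obtain ⟨T, hTeq⟩ := Set.ncard_eq_one.1 ht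
    have hT : M.IsCircuit T ∧ T.ncard = 3 := by
      have : T ∈ {C : Set α | M.IsCircuit C ∧ C.ncard = 3} := by rw [hTeq]; exact Set.mem_singleton T
      exact this
    by_cases h42 : 2 ≤ {C : Set α | M.IsCircuit C ∧ C.ncard = 4}.ncard
    · -- the triangle and two `4`-circuits
      obtain ⟨C₁, C₂, hC₁, hC₂, hne⟩ := (Set.one_lt_ncard_iff h4fin).1 (by omega)
      have hne₁ : T ≠ C₁ := fun h => by have h3 := hT.2; rw [h, hC₁.2] at h3; omega
      have hne₂ : T ≠ C₂ := fun h => by have h3 := hT.2; rw [h, hC₂.2] at h3; omega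
      have hh := S2.top_five_two_of_three M hR hn hT.1 hC₁.1 hC₂.1 hne₁ hne₂ hne
      have hle := S2.ncard_top_five_le_two_of_three M hh
      rw [← hTop] at hle
      have hcount := S2.ncard_two_of_three_family_add_le M hn hT.1.subset_ground hC₁.1.subset_ground hC₂.1.subset_ground
      obtain ⟨a1, a2, a3, b1, b2, b3, b4, b5, b6, c1, c2, c3, c4⟩ := S2.three_circuits_ncard_bounds M hT.1 hC₁.1 hC₂.1 hne₁ hne₂ hne
      have e₁ := hT.2
      have e₂ := hC₁.2
      have e₃ := hC₂.2
      have hx := S2.hit_two_of_three_344 _ _ _ _ _ (by omega) (by omega) (by omega) (by omega) (by omega) (by omega)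
        c1 c2 c3 (by omega) hcount
      have hS := S2.ncard_spanning_add_le_of_three_circuits_nineteen M hR hn hT.1 hC₁.1 hC₂.1 (by omega) (by omega) (by omega)
      rw [hT.2, hC₁.2, hC₂.2] at hS
      have m12 : (19 - (T ∪ C₁).ncard).choose 6 ≤ 3003 := S2.choose_six_le_of_five_le (by omega)
      have m13 : (19 - (T ∪ C₂).ncard).choose 6 ≤ 3003 := S2.choose_six_le_of_five_le (by omega)
      have m23 : (19 - (C₁ ∪ C₂).ncard).choose 6 ≤ 3003 := S2.choose_six_le_of_five_le (by omega)
      norm_num [Nat.choose] at hS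
      have hS' : {X : Set α | X ⊆ M.E ∧ M.eRk X = M.eRank}.ncard ≤ 34787 := by omega
      have hU' : Matroid.topCount M 13 5 ≤ 16078 := by omega
      exact cellA _ 34787 135 _ hU' hS' (by norm_num) (by norm_num) (by norm_num [Nat.choose]) hA
    push Not at h42
    by_cases h41 : 1 ≤ {C : Set α | M.IsCircuit C ∧ C.ncard = 4}.ncard
    · -- the triangle and one `4`-circuit: their union has `≤ 7` points
      obtain ⟨C, hC⟩ := Set.nonempty_of_ncard_ne_zero (s := {C : Set α | M.IsCircuit C ∧ C.ncard = 4}) (by omega)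
      have hne : T ≠ C := fun h => by have h3 := hT.2; rw [h, hC.2] at h3; omega
      have hhit := S2.top_five_inter_union_nonempty M hR hn hT.1 hC.1 hne
      have h5b := htop5_le (T ∪ C) (T ∪ C) hhit hhit
      rw [Set.union_self] at h5b
      have hY := hcompl hT.1.subset_ground hC.1.subset_ground
      rw [hT.2, hC.2] at hY
      have hch : (12 : ℕ).choose 5 ≤ (M.E \ (T ∪ C)).ncard.choose 5 := Nat.choose_le_choose 5 (by omega)
      norm_num [Nat.choose] at hch
      have hU' : Matroid.topCount M 13 5 ≤ 14175 := by omega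
      exact cellA _ 43796 153 _ hU' hSkit (by norm_num) (by norm_num) (by norm_num [Nat.choose]) hA
    push Not at h41
    by_cases h51 : 1 ≤ {C : Set α | M.IsCircuit C ∧ C.ncard = 5}.ncard
    · -- the triangle and a `5`-circuit: their union has `≤ 8` points
      obtain ⟨C, hC⟩ := Set.nonempty_of_ncard_ne_zero (s := {C : Set α | M.IsCircuit C ∧ C.ncard = 5}) (by omega)
      have hne : T ≠ C := fun h => by have h3 := hT.2; rw [h, hC.2] at h3; omega
      have hhit := S2.top_five_inter_union_nonempty M hR hn hT.1 hC.1 hne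
      have h5b := htop5_le (T ∪ C) (T ∪ C) hhit hhit
      rw [Set.union_self] at h5b
      have hY := hcompl hT.1.subset_ground hC.1.subset_ground
      rw [hT.2, hC.2] at hY
      have hch : (11 : ℕ).choose 5 ≤ (M.E \ (T ∪ C)).ncard.choose 5 := Nat.choose_le_choose 5 (by omega)
      norm_num [Nat.choose] at hch
      have hU' : Matroid.topCount M 13 5 ≤ 14400 := by omega
      exact cellA _ 43796 153 _ hU' hSkit (by norm_num) (by norm_num) (by norm_num [Nat.choose]) hA
    · push Not at h51
      have hU' : Matroid.topCount M 13 5 ≤ 12650 := by omega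
      exact cellA _ 43796 153 _ hU' hSkit (by norm_num) (by norm_num) (by norm_num [Nat.choose]) hA
  by_cases ht2 : t = 2
  · subst ht2
    obtain ⟨T₁, T₂, hT₁, hT₂, hne⟩ := (Set.one_lt_ncard_iff hTfin).1 (by omega)
    have hu5 : 5 ≤ (T₁ ∪ T₂).ncard := S2.five_le_ncard_union_of_triangles M hC1 hT₁.1 hT₁.2 hT₂.1 hT₂.2 hne
    by_cases h41 : 1 ≤ {C : Set α | M.IsCircuit C ∧ C.ncard = 4}.ncard
    · -- the two triangles and a `4`-circuit
      obtain ⟨Q, hQ⟩ := Set.nonempty_of_ncard_ne_zero (s := {C : Set α | M.IsCircuit C ∧ C.ncard = 4}) (by omega)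
      have hne₁ : T₁ ≠ Q := fun h => by have h3 := hT₁.2; rw [h, hQ.2] at h3; omega
      have hne₂ : T₂ ≠ Q := fun h => by have h3 := hT₂.2; rw [h, hQ.2] at h3; omega
      have hh := S2.top_five_two_of_three M hR hn hT₁.1 hT₂.1 hQ.1 hne hne₁ hne₂
      have hle := S2.ncard_top_five_le_two_of_three M hh
      rw [← hTop] at hle
      have hcount := S2.ncard_two_of_three_family_add_le M hn hT₁.1.subset_ground hT₂.1.subset_ground hQ.1.subset_ground
      obtain ⟨a1, a2, a3, b1, b2, b3, b4, b5, b6, c1, c2, c3, c4⟩ := S2.three_circuits_ncard_bounds M hT₁.1 hT₂.1 hQ.1 hne hne₁ hne₂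
      have e₁ := hT₁.2
      have e₂ := hT₂.2
      have e₃ := hQ.2
      have hS := S2.ncard_spanning_add_le_of_three_circuits_nineteen M hR hn hT₁.1 hT₂.1 hQ.1 (by omega) (by omega) (by omega)
      rw [hT₁.2, hT₂.2, hQ.2] at hS
      have m13 : (19 - (T₁ ∪ Q).ncard).choose 6 ≤ 3003 := S2.choose_six_le_of_five_le (by omega)
      have m23 : (19 - (T₂ ∪ Q).ncard).choose 6 ≤ 3003 := S2.choose_six_le_of_five_le (by omega)
      norm_num [Nat.choose] at hS
      by_cases hmeet : (T₁ ∩ T₂).Nonempty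
      · -- the triangles meet: `|T₁ ∪ T₂| = 5`; the `239` supersets of a triangle are not top `5`-sets
        have hi : 0 < (T₁ ∩ T₂).ncard := (Set.ncard_pos ((hfin hT₁.1).subset Set.inter_subset_left)).2 hmeet
        have hui := Set.ncard_union_add_ncard_inter T₁ T₂ (hfin hT₁.1) (hfin hT₂.1)
        have hu12 : (T₁ ∪ T₂).ncard = 5 := by omega
        have hsub := S2.ncard_top_five_add_le_of_two_meeting_triangles M hn hC1 hT₁.1 hT₁.2 hT₂.1 hT₂.2 hne hmeet Q hh
        rw [← hTop] at hsub
        have hx := S2.hit_two_of_three_334 _ _ _ _ _ (by omega) (by omega) (by omega) (by omega) (by omega) (by omega)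
          c1 c2 c3 (by omega) hcount
        have m12 : (19 - (T₁ ∪ T₂).ncard).choose 6 ≤ 3003 := by
          rw [hu12]; norm_num [Nat.choose]
        have hS' : {X : Set α | X ⊆ M.E ∧ M.eRk X = M.eRank}.ncard ≤ 31784 := by omega
        have hU' : Matroid.topCount M 13 5 ≤ 16331 := by omega
        exact cellA _ 31784 131 _ hU' hS' (by norm_num) (by norm_num) (by norm_num [Nat.choose]) hA
      · -- the triangles are disjoint: `|T₁ ∪ T₂| = 6`
        have hdis : Disjoint T₁ T₂ := by
          rw [Set.disjoint_iff_inter_eq_empty]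
          exact Set.not_nonempty_iff_eq_empty.1 hmeet
        have hu12 : (T₁ ∪ T₂).ncard = 6 := by
          rw [Set.ncard_union_eq hdis (hfin hT₁.1) (hfin hT₂.1), hT₁.2, hT₂.2]
        rw [hu12] at hcount c1 c4
        have hx := S2.hit_two_of_three_334_disjoint _ _ _ _ (by omega) (by omega) (by omega) (by omega)
          c1 c2 c3 (by omega) hcount
        have m12 : (19 - (T₁ ∪ T₂).ncard).choose 6 ≤ 1716 := by
          rw [hu12]; norm_num [Nat.choose]
        have hS' : {X : Set α | X ⊆ M.E ∧ M.eRk X = M.eRank}.ncard ≤ 30497 := by omega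
        have hU' : Matroid.topCount M 13 5 ≤ 15953 := by omega
        exact cellA _ 30497 129 _ hU' hS' (by norm_num) (by norm_num) (by norm_num [Nat.choose]) hA
    · -- no `4`-circuit: every top `5`-set meets `T₁ ∪ T₂`
      push Not at h41
      have hhit := S2.top_five_inter_union_nonempty M hR hn hT₁.1 hT₂.1 hne
      have h5b := htop5_le (T₁ ∪ T₂) (T₁ ∪ T₂) hhit hhit
      rw [Set.union_self] at h5b
      have hY := hcompl hT₁.1.subset_ground hT₂.1.subset_ground
      rw [hT₁.2, hT₂.2] at hY
      have hch : (13 : ℕ).choose 5 ≤ (M.E \ (T₁ ∪ T₂)).ncard.choose 5 := Nat.choose_le_choose 5 (by omega)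
      norm_num [Nat.choose] at hch
      have hU' : Matroid.topCount M 13 5 ≤ 14135 := by omega
      exact cellA _ 43796 154 _ hU' hSkit (by norm_num) (by norm_num) (by norm_num [Nat.choose]) hA
  -- `t = 3`: a top `5`-set meets two of the three triangles
  have ht3e : t = 3 := by omega
  subst ht3e
  have hS' := hspan3 le_rfl
  obtain ⟨T₁, T₂, T₃, hT₁, hT₂, hT₃, h12, h13, h23⟩ := (Set.two_lt_ncard_iff hTfin).1 (by omega)
  have hh := S2.top_five_two_of_three M hR hn hT₁.1 hT₂.1 hT₃.1 h12 h13 h23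
  have hle := S2.ncard_top_five_le_two_of_three M hh
  rw [← hTop] at hle
  have hcount := S2.ncard_two_of_three_family_add_le M hn hT₁.1.subset_ground hT₂.1.subset_ground hT₃.1.subset_ground
  obtain ⟨a1, a2, a3, -, -, -, -, -, -, c1, c2, c3, c4⟩ := S2.three_circuits_ncard_bounds M hT₁.1 hT₂.1 hT₃.1 h12 h13 h23
  have e₁ := hT₁.2
  have e₂ := hT₂.2
  have e₃ := hT₃.2
  have l12 := S2.five_le_ncard_union_of_triangles M hC1 hT₁.1 hT₁.2 hT₂.1 hT₂.2 h12
  have l13 := S2.five_le_ncard_union_of_triangles M hC1 hT₁.1 hT₁.2 hT₃.1 hT₃.2 h13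
  have l23 := S2.five_le_ncard_union_of_triangles M hC1 hT₂.1 hT₂.2 hT₃.1 hT₃.2 h23
  have hx := S2.hit_two_of_three_333 _ _ _ _ _ l12 (by omega) l13 (by omega) l23 (by omega) c1 c2 c3 (by omega) hcount
  have hU' : Matroid.topCount M 13 5 ≤ 15775 := by omega
  exact cellA _ 28781 127 _ hU' hS' (by norm_num) (by norm_num) (by norm_num [Nat.choose]) hA

/-- **THE CELL `(13, 6)` MODULO THE SPREAD CAP `s₄ ≤ 30` on its coloop-free spread core**: `RLS M 13 5` for every
`e`-free core of rank `13` on `19` points, given `s₄ ≤ 30` on every coloop-free spread core of that size (p1's spread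
chain `S1CoreCapSpreadChainRows`; hypothesis `hcap`). Nothing about the cell is claimed unconditionally. -/
theorem c025_core_five_thirteen_six_of_cap
    (hcap : ∀ (M : Matroid α) [M.Finite], M.eRank = ((13 : ℕ) : ℕ∞) → M.E.ncard = 13 + 6 →
      (∀ e ∈ M.E, ∃ A ⊆ M.E \ {e}, e ∉ M.closure A ∧ e ∉ M.closure ((M.E \ {e}) \ A)) → (∀ e, ¬ M.IsColoop e) →
      ¬ (∃ W ⊆ M.E, W.ncard ≤ 9 ∧ W.encard = M.eRk W + 4) →
      {C : Set α | M.IsCircuit C ∧ C.ncard = 4}.ncard ≤ 30)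
    (M : Matroid α) [M.Finite]
    (hR : M.eRank = ((13 : ℕ) : ℕ∞)) (hn : M.E.ncard = 13 + 6)
    (hfree : ∀ e ∈ M.E, ∃ A ⊆ M.E \ {e}, e ∉ M.closure A ∧ e ∉ M.closure ((M.E \ {e}) \ A)) : RLS M 13 5 := by
  refine c025_core_five_thirteen_six_of_three (fun M' _ hR' hn' hfree' hK' h4' ht3' => ?_) M hR hn hfree
  exact c025_thirteen_six_cf_spread_le_three_of_cap M' hR' hn' hfree' hK' h4' (hcap M' hR' hn' hfree' hK' h4') ht3'

end ThmN

end PercRepro
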